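import Mathlib
import Literature.Analysis.FluidPDE.Tao2016AveragedNS.ShiftSetCascadeFlows
import Literature.Analysis.FluidPDE.Tao2016AveragedNS.ShiftSetCascadeFlux
import Summits.NavierStokesRegularity.NavierStokesRegularity.Theorems.TaoLadderRungTwoFlatCertificateGlueReadoutLStepOn
import HarnessLib

/-!
# Certificate glue on a shift set `𝕊`, XXXV-c: TRAPPING AND LANDING FROM BRANCH CHAINS WITH PER-BRANCH GAUGES AND READOUT-L (helper for items
  stmt-NavierStokesRegularity-22987 `FlatGapCertificatesV2` (crux K_A♭ of route TaoLadderRungTwoFlat) and stmt-24295 K_A₂(64); cell harvest/h2-tao-ladder,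
  p1 g17; theory-1 g29 findings F-40 (point-reference readout has no instance ⇒ READOUT-L) and F-44 (the certificate of record carries a WEIGHT TABLE
  PER BRANCH ⇒ `ωq qz lev prec p Sp Sm bD cB` indexed by the branch); referee c73 P158)

`hland_of_pbranches` / `hland_of_pbranchMeshes'` = glue X-c `hland_of_branches` / XXXI `hland_of_branchMeshes'` with a PER-BRANCH section functional
`sec b` and level `lev b` (the crossing is found by the intermediate value theorem branch by branch, so nothing global is needed); `htrap_of_chainChecksP` =
glue XXIX-d `htrap_of_chainChecksG` with the weights `ωq b`, the coefficient table `cB b`, the precision `prec b`, the order `p b` and the global Booleans'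
data `Sp b, Sm b, bD b` indexed by the branch (every conclusion is state-space and gauge-free); `hland_of_chainChecksL` = glue XXXV-b `hland_of_chainChecksG`
per branch, with the readout tested by glue XXXIV-c `checkReadoutL` on the section-node PARALLELEPIPED and the reference states ranging over the fat core
boxes `InCoreBox (Cs b j) (cen b j) (chw b j) ⊆ Core`.

HONEST FRAMING: Tao-type MODEL lattices (Tao 2016 §4/§6 vocabulary, shift-set parametrised); checker soundness — NO certificate instance exists in the
tree, nothing is certified here, no stub is closed, nothing here is a statement about the Navier–Stokes equations.
-/

-- the sub-problem namespace repeats the summit name by design (D-0017)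
set_option linter.dupNamespace false

namespace Summit.NavierStokesRegularity.NavierStokesRegularity.Theorems

open Set Filter Topology Finset Literature.Analysis.FluidPDE Literature.Analysis.FluidPDE.TaoCascade
open Summit.NavierStokesRegularity.NavierStokesRegularity.Theorems.TaylorModelCert

namespace CertificateGlueOn

variable {m : ℕ} {𝕊 : Finset (ℤ × ℤ × ℤ)} {ε₀ : ℝ} {α : Fin m → Fin m → Fin m → ℤ × ℤ × ℤ → ℝ} {Kb Ka : ℤ}
  {Eb Et : ℝ} {M : ℤ → ℝ}

/-! ### The landing clause with a per-branch section functional -/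

section Branches

variable {ι : Type*} {Core : (Fin m → ℤ → ℝ) → Prop} {w : ℤ → ℝ} {r : ℝ}
  {Box : ι → (Fin m → ℤ → ℝ) → Prop} {t : ι → ℕ → ℝ}
  {Node Hull : ι → ℕ → (Fin m → ℤ → ℝ) → Prop}

/-- **THE LANDING CLAUSE `hland` FROM PER-BRANCH LANDING WINDOWS, PER-BRANCH SECTION**: glue X-c `hland_of_branches` with the section functional `sec b`
and its level `lev b` depending on the branch (each branch reads its own trajectories at their own crossing of `{sec b = lev b}`).
[cite: Tao2016AveragedNS, §6.3–6.4 Props. 6.4–6.5 (statement shape of a renormalisation certificate; the readout at the crossing); cell certificate format, branch layer] -/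
theorem hland_of_pbranches {ρ θ₀ σ c₀ Zx : ℝ} {i₀ : Fin m} {sec : ι → (Fin m → ℤ → ℝ) → ℝ} {lev : ι → ℝ}
    {tlo thi : ι → ℝ}
    (hcover : ∀ (z S₀ : Fin m → ℤ → ℝ), Core z →
      (∀ i k, -Kb ≤ k → k ≤ Ka → w k * |S₀ i k - z i k| ≤ r) → ∃ b, Box b S₀)
    (hwin : ∀ b, 0 < tlo b ∧ tlo b ≤ thi b ∧ thi b ≤ c₀)
    (hsec : ∀ (b : ι) (s : ℝ) (S : Fin m → ℤ → ℝ → ℝ), WindowRun 𝕊 ε₀ α Kb Ka Eb Et s S →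
      ContinuousOn (fun u => sec b (slice S u)) (Icc 0 s))
    (hbefore : ∀ (b : ι) (S : Fin m → ℤ → ℝ → ℝ), Box b (slice S 0) →
      WindowRun 𝕊 ε₀ α Kb Ka Eb Et (tlo b) S →
      (∀ i k, -Kb ≤ k → k ≤ Ka → ∀ u ∈ Icc 0 (tlo b), |S i k u| ≤ M k) → sec b (slice S (tlo b)) < lev b)
    (hafter : ∀ (b : ι) (S : Fin m → ℤ → ℝ → ℝ), Box b (slice S 0) →
      WindowRun 𝕊 ε₀ α Kb Ka Eb Et (thi b) S →
      (∀ i k, -Kb ≤ k → k ≤ Ka → ∀ u ∈ Icc 0 (thi b), |S i k u| ≤ M k) → lev b ≤ sec b (slice S (thi b)))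
    (hread : ∀ (b : ι) (s : ℝ) (S : Fin m → ℤ → ℝ → ℝ), tlo b ≤ s → s ≤ thi b → Box b (slice S 0) →
      WindowRun 𝕊 ε₀ α Kb Ka Eb Et s S →
      (∀ i k, -Kb ≤ k → k ≤ Ka → ∀ u ∈ Icc 0 s, |S i k u| ≤ M k) → sec b (slice S s) = lev b →
      ∃ (a : ℝ) (z' : Fin m → ℤ → ℝ), 0 < a ∧ (1 + ε₀) ^ (-θ₀) ≤ a ∧ (1 + σ) * a ≤ |S i₀ 1 s| ∧ Core z' ∧
        (∀ i k, -Kb ≤ k → k + 1 ≤ Ka → w k * |S i (1 + k) s / a - z' i k| ≤ ρ * r) ∧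
        (∀ (i : Fin m) (v : ℝ), |v| ≤ Et → w Ka * |v / a - z' i Ka| ≤ ρ * r) ∧
        (∀ i, |S i (-Kb) s| ≤ a * Zx)) :
    ∀ (z : Fin m → ℤ → ℝ) (S : Fin m → ℤ → ℝ → ℝ), Core z →
      (∀ i k, -Kb ≤ k → k ≤ Ka → w k * |S i k 0 - z i k| ≤ r) →
      (∀ i k, -Kb ≤ k → k ≤ Ka → ∀ u ∈ Icc 0 c₀,
        HasDerivWithinAt (S i k) (quadTermOn 𝕊 ε₀ α S i k u) (Icc 0 c₀) u) →
      (∀ i, ContinuousOn (S i (-Kb - 1)) (Icc 0 c₀)) → (∀ i, ContinuousOn (S i (Ka + 1)) (Icc 0 c₀)) →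
      (∀ i, ∀ u ∈ Icc 0 c₀, |S i (-Kb - 1) u| ≤ Eb) →
      (∀ i, ∀ u ∈ Icc 0 c₀, |S i (Ka + 1) u| ≤ Et) →
      (∀ i k, -Kb ≤ k → k ≤ Ka → ∀ u ∈ Icc 0 c₀, |S i k u| ≤ M k) →
        ∃ (τ₁ a : ℝ) (z' : Fin m → ℤ → ℝ), 0 < τ₁ ∧ τ₁ ≤ c₀ ∧ 0 < a ∧ (1 + ε₀) ^ (-θ₀) ≤ a ∧
          (1 + σ) * a ≤ |S i₀ 1 τ₁| ∧ Core z' ∧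
          (∀ i k, -Kb ≤ k → k + 1 ≤ Ka → w k * |S i (1 + k) τ₁ / a - z' i k| ≤ ρ * r) ∧
          (∀ (i : Fin m) (v : ℝ), |v| ≤ Et → w Ka * |v / a - z' i Ka| ≤ ρ * r) ∧
          (∀ i, |S i (-Kb) τ₁| ≤ a * Zx) := by
  intro z S hz hball hder hcb hct hbb hbt hM
  have hrun : WindowRun 𝕊 ε₀ α Kb Ka Eb Et c₀ S := ⟨hder, hcb, hct, hbb, hbt⟩
  obtain ⟨b, hb⟩ := hcover z (slice S 0) hz (by simpa [slice] using hball)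
  obtain ⟨hlo0, hlohi, hhic⟩ := hwin b
  have hMres : ∀ s', s' ≤ c₀ → ∀ i k, -Kb ≤ k → k ≤ Ka → ∀ u ∈ Icc 0 s', |S i k u| ≤ M k :=
    fun s' hs' i k hk1 hk2 u hu => hM i k hk1 hk2 u ⟨hu.1, hu.2.trans hs'⟩
  have h1 : sec b (slice S (tlo b)) < lev b :=
    hbefore b S hb (hrun.mono (hlohi.trans hhic)) (hMres _ (hlohi.trans hhic))
  have h2 : lev b ≤ sec b (slice S (thi b)) := hafter b S hb (hrun.mono hhic) (hMres _ hhic)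
  have hcont : ContinuousOn (fun u => sec b (slice S u)) (Icc (tlo b) (thi b)) :=
    (hsec b c₀ S hrun).mono (Icc_subset_Icc hlo0.le hhic)
  obtain ⟨τ₁, hτ₁, hτ₁lev⟩ := intermediate_value_Icc hlohi hcont ⟨h1.le, h2⟩
  obtain ⟨a, z', ha, haθ, haσ, hz', hmatch, htop, hexit⟩ :=
    hread b τ₁ S hτ₁.1 hτ₁.2 hb (hrun.mono (hτ₁.2.trans hhic)) (hMres _ (hτ₁.2.trans hhic)) hτ₁lev
  exact ⟨τ₁, a, z', lt_of_lt_of_le hlo0 hτ₁.1, hτ₁.2.trans hhic, ha, haθ, haσ, hz', hmatch, htop, hexit⟩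

/-- **THE LANDING CLAUSE `hland` FROM PER-BRANCH MESH CERTIFICATES WITH TRAJECTORY READOUTS, PER-BRANCH SECTION**: glue XXXI `hland_of_branchMeshes'`
with the section functional `sec b` / level `lev b` depending on the branch. [cite: Tao2016AveragedNS, §6.3–6.4 Props. 6.4–6.5 (statement shape of a renormalisation certificate; the readout at the crossing); cell certificate format, branch layer from mesh layer] -/
theorem hland_of_pbranchMeshes' {ρ θ₀ σ c₀ Zx : ℝ} {i₀ : Fin m} {sec : ι → (Fin m → ℤ → ℝ) → ℝ} {lev : ι → ℝ}
    {j₁ j₂ : ι → ℕ}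
    (hcover : ∀ (z S₀ : Fin m → ℤ → ℝ), Core z →
      (∀ i k, -Kb ≤ k → k ≤ Ka → w k * |S₀ i k - z i k| ≤ r) → ∃ b, Box b S₀)
    (hj : ∀ b, j₁ b ≤ j₂ b) (ht0 : ∀ b, t b 0 = 0) (hmono : ∀ b j, j < j₂ b + 1 → t b j < t b (j + 1))
    (hpos : ∀ b, 0 < t b (j₁ b)) (hc₀ : ∀ b, t b (j₂ b + 1) ≤ c₀) (hbox : ∀ b y, Box b y → Node b 0 y)
    (hstep : ∀ b j, j < j₂ b + 1 → StepCert 𝕊 ε₀ α Kb Ka Eb Et M (t b) (Node b) (Hull b) j)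
    (hsec : ∀ (b : ι) (s : ℝ) (S : Fin m → ℤ → ℝ → ℝ), WindowRun 𝕊 ε₀ α Kb Ka Eb Et s S →
      ContinuousOn (fun u => sec b (slice S u)) (Icc 0 s))
    (hbefore : ∀ b y, Node b (j₁ b) y → sec b y < lev b) (hafter : ∀ b y, Node b (j₂ b + 1) y → lev b ≤ sec b y)
    (hread : ∀ b j, j₁ b ≤ j → j ≤ j₂ b → StepRead 𝕊 ε₀ α Kb Ka Eb Et M (t b) (Node b) (fun y => sec b y = lev b →
      ∃ (a : ℝ) (z' : Fin m → ℤ → ℝ), 0 < a ∧ (1 + ε₀) ^ (-θ₀) ≤ a ∧ (1 + σ) * a ≤ |y i₀ 1| ∧ Core z' ∧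
        (∀ i k, -Kb ≤ k → k + 1 ≤ Ka → w k * |y i (1 + k) / a - z' i k| ≤ ρ * r) ∧
        (∀ (i : Fin m) (v : ℝ), |v| ≤ Et → w Ka * |v / a - z' i Ka| ≤ ρ * r) ∧
        (∀ i, |y i (-Kb)| ≤ a * Zx)) j) :
    ∀ (z : Fin m → ℤ → ℝ) (S : Fin m → ℤ → ℝ → ℝ), Core z →
      (∀ i k, -Kb ≤ k → k ≤ Ka → w k * |S i k 0 - z i k| ≤ r) →
      (∀ i k, -Kb ≤ k → k ≤ Ka → ∀ u ∈ Icc 0 c₀,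
        HasDerivWithinAt (S i k) (quadTermOn 𝕊 ε₀ α S i k u) (Icc 0 c₀) u) →
      (∀ i, ContinuousOn (S i (-Kb - 1)) (Icc 0 c₀)) → (∀ i, ContinuousOn (S i (Ka + 1)) (Icc 0 c₀)) →
      (∀ i, ∀ u ∈ Icc 0 c₀, |S i (-Kb - 1) u| ≤ Eb) →
      (∀ i, ∀ u ∈ Icc 0 c₀, |S i (Ka + 1) u| ≤ Et) →
      (∀ i k, -Kb ≤ k → k ≤ Ka → ∀ u ∈ Icc 0 c₀, |S i k u| ≤ M k) →
        ∃ (τ₁ a : ℝ) (z' : Fin m → ℤ → ℝ), 0 < τ₁ ∧ τ₁ ≤ c₀ ∧ 0 < a ∧ (1 + ε₀) ^ (-θ₀) ≤ a ∧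
          (1 + σ) * a ≤ |S i₀ 1 τ₁| ∧ Core z' ∧
          (∀ i k, -Kb ≤ k → k + 1 ≤ Ka → w k * |S i (1 + k) τ₁ / a - z' i k| ≤ ρ * r) ∧
          (∀ (i : Fin m) (v : ℝ), |v| ≤ Et → w Ka * |v / a - z' i Ka| ≤ ρ * r) ∧
          (∀ i, |S i (-Kb) τ₁| ≤ a * Zx) := by
  have htmono : ∀ b j j', j ≤ j' → j' ≤ j₂ b + 1 → t b j ≤ t b j' := by
    intro b j j' hjj' hj'
    induction j' with
    | zero => rw [Nat.le_zero.mp hjj']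
    | succ j' ih =>
      rcases Nat.lt_or_ge j (j' + 1) with h | h
      · exact (ih (by omega) (by omega)).trans (hmono b j' (by omega)).le
      · rw [le_antisymm hjj' h]
  refine hland_of_pbranches (tlo := fun b => t b (j₁ b)) (thi := fun b => t b (j₂ b + 1)) hcover
    (fun b => ⟨hpos b, htmono b _ _ (by have := hj b; omega) le_rfl, hc₀ b⟩) hsec
    (fun b => sec_lt_of_mesh (ht0 b) (fun j hj' => hmono b j (by have := hj b; omega)) (hbox b)
      (fun j hj' => hstep b j (by have := hj b; omega)) (hbefore b))
    (fun b => le_sec_of_mesh (ht0 b) (hmono b) (hbox b) (hstep b) (hafter b))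
    (fun b s S hs1 hs2 hb hrun hM => ?_)
  exact read_of_mesh' (P := fun y => sec b y = lev b → _) (hj b) (ht0 b) (hmono b) (hpos b) (hbox b) (hstep b)
    (fun y hy hlev => absurd hlev (hbefore b y hy).ne) (fun j hj1' hj2' => hread b j hj1' hj2')
    s S hs1 hs2 hb hrun hM

end Branches

/-! ### The trapping and landing clauses from branch chains with per-branch gauges -/

variable {ι : Type*} {Core : (Fin m → ℤ → ℝ) → Prop}

/-- **THE TRAPPING CLAUSE `htrap` FROM CHECKED TRANSIT BRANCH CHAINS, PER-BRANCH GAUGE**: glue XXIX-d `htrap_of_chainChecksG` with the weights `ωq b`,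
the coefficient table `cB b`, `prec b`, `p b` and `Sp b, Sm b, bD b` indexed by the branch (`checkGlobalG` once per branch); the cover maps a core state
to the weighted start box of a branch in THAT branch's gauge.
[cite: Tao2016AveragedNS, §6.3–6.4 Props. 6.4–6.5 (statement shape of a renormalisation certificate); cell certificate format, branch checker, per-branch gauge] -/
theorem htrap_of_chainChecksP {w : ℤ → ℝ} {r : ℝ} (hKb : 0 ≤ Kb) (hKa : 1 ≤ Ka) {shifts : List (ℤ × ℤ × ℤ)} (hnd : shifts.Nodup)
    (h𝕊 : IsNearestNeighbourSet shifts.toFinset) {q : ℚ} {cB : ι → Fin m → ℤ → Fin m → Fin m → ℤ × ℤ × ℤ → IntervalD}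
    {αq : Fin m → Fin m → Fin m → ℤ × ℤ × ℤ → ℚ} {ωq : ι → Fin m → ℤ → ℚ} (hω : ∀ b i k, 0 < ωq b i k)
    (hcoef : ∀ b, CoefBoxOK shifts (q : ℝ) (fun i₁ i₂ i μ => (αq i₁ i₂ i μ : ℝ)) Kb Ka (fun i k => (ωq b i k : ℝ)) (cB b))
    {prec p : ι → ℕ} {kexp nexp : ℕ} {Sp Sm : ι → IntervalD} {bD : ι → Dyad} {Eb Et c : ℚ} {Mq : ℤ → ℚ}
    {rec : ι → ℕ → VRec} {N : ι → ℕ}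
    (hg : ∀ b, checkGlobalG m Kb Ka (prec b) shifts (cB b) q (Sp b) (Sm b) (bD b) = true)
    (hs : ∀ b j, j < N b → checkStepG m Kb Ka (prec b) (p b) kexp nexp shifts (cB b) αq (ωq b) (Sp b) (Sm b) (bD b) Eb Et (rec b) j = true)
    (htr : ∀ b j, j < N b → checkTransit m Kb Ka (ωq b) Mq (rec b j).lo (rec b j).hi = true)
    (hc : ∀ b, c ≤ sumHV (rec b) (N b))
    (hid : ∀ b, checkIdFrame (m * winLen Kb Ka) (rec b 0).C = true) (hE : ∀ b, checkNonneg (m * winLen Kb Ka) (rec b 0).E = true)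
    (hcover : ∀ (z S₀ : Fin m → ℤ → ℝ), Core z → (∀ i k, -Kb ≤ k → k ≤ Ka → w k * |S₀ i k - z i k| ≤ r) →
      ∃ b, ∀ d, |pxcoord Kb Ka (fun i k => (ωq b i k : ℝ)) S₀ d - dvec (n := m * winLen Kb Ka) (rec b 0).x d| ≤
        dvec (n := m * winLen Kb Ka) (rec b 0).r d) :
    ∀ (s : ℝ) (z : Fin m → ℤ → ℝ) (S : Fin m → ℤ → ℝ → ℝ), Core z → 0 < s → s ≤ (c : ℝ) →
      (∀ i k, -Kb ≤ k → k ≤ Ka → w k * |S i k 0 - z i k| ≤ r) →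
      (∀ i k, -Kb ≤ k → k ≤ Ka → ∀ u ∈ Icc 0 s,
        HasDerivWithinAt (S i k) (quadTermOn shifts.toFinset (q : ℝ) (fun i₁ i₂ i μ => (αq i₁ i₂ i μ : ℝ)) S i k u) (Icc 0 s) u) →
      (∀ i, ContinuousOn (S i (-Kb - 1)) (Icc 0 s)) → (∀ i, ContinuousOn (S i (Ka + 1)) (Icc 0 s)) →
      (∀ i, ∀ u ∈ Icc 0 s, |S i (-Kb - 1) u| ≤ (Eb : ℝ)) →
      (∀ i, ∀ u ∈ Icc 0 s, |S i (Ka + 1) u| ≤ (Et : ℝ)) →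
      (∀ i k, -Kb ≤ k → k ≤ Ka → ∀ u ∈ Icc 0 s, |S i k u| ≤ (Mq k : ℝ)) →
        ∀ i k, -Kb ≤ k → k ≤ Ka → ∀ u ∈ Icc 0 s, |S i k u| < (Mq k : ℝ) := by
  have hbr := fun b => transitBranchG_of_checks hKb hKa hnd h𝕊 (hω b) (hcoef b) (hg b) (hs b) (htr b)
  exact htrap_of_branchMeshes
    (Box := fun b S₀ => ∀ d, |pxcoord Kb Ka (fun i k => (ωq b i k : ℝ)) S₀ d - dvec (n := m * winLen Kb Ka) (rec b 0).x d| ≤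
      dvec (n := m * winLen Kb Ka) (rec b 0).r d)
    (t := fun b => tOfV (rec b)) (Node := fun b => nodeOfV Kb Ka (ωq b) (rec b))
    (Hull := fun b => hullOfG Kb Ka shifts (cB b) (ωq b) (rec b))
    hcover (fun b => (hbr b).1) (fun b => (hbr b).2.1) (fun b => le_tOfV_of_le_sumHV (hc b))
    (fun b y hy => node0_of_boxV (hid b) (hE b) hy) (fun b => (hbr b).2.2.1) (fun b => (hbr b).2.2.2)

/-- **THE LANDING CLAUSE `hland` FROM CHECKED BRANCH CHAINS, PER-BRANCH GAUGE, READOUT-L.** Per branch `b`: its own weights `ωq b`, table `cB b`,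
section weights `qz b` / level `lev b`, records `rec b` with `checkStepG` for `j ≤ j₂ b`, readout steps `j₁ b ≤ j ≤ j₂ b` each with a section record
(`checkSection`) and a READOUT-L test `checkReadoutL` on the tabulated section-node parallelepiped against the fat core box `(Cs b j, cen b j, chw b j)`
(every such box inside `Core`), the sign tests `checkSecBelow` / `checkSecAbove`, the clocks, the identity start frame; and the fattened core covered by
the weighted start boxes (branch `b`'s own gauge) ⇒ the clause `hland` of glue IV verbatim (`w := wq`, `θ₀ := θn/θd`).
[cite: Tao2016AveragedNS, §6.3–6.4 Props. 6.4–6.5 (statement shape of a renormalisation certificate; the readout at the crossing); cell certificate format, landing checker L, per-branch gauge] -/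
theorem hland_of_chainChecksL {wq : ℤ → ℚ} {r : ℚ} (hKb : 0 ≤ Kb) (hKa : 1 ≤ Ka) {shifts : List (ℤ × ℤ × ℤ)} (hnd : shifts.Nodup)
    (h𝕊 : IsNearestNeighbourSet shifts.toFinset) {q : ℚ} (hq : 0 < 1 + (q : ℝ))
    {αq : Fin m → Fin m → Fin m → ℤ × ℤ × ℤ → ℚ} {ωq : ι → Fin m → ℤ → ℚ} (hω : ∀ b i k, 0 < ωq b i k)
    {cB : ι → Fin m → ℤ → Fin m → Fin m → ℤ × ℤ × ℤ → IntervalD}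
    (hcoef : ∀ b, CoefBoxOK shifts (q : ℝ) (fun i₁ i₂ i μ => (αq i₁ i₂ i μ : ℝ)) Kb Ka (fun i k => (ωq b i k : ℝ)) (cB b))
    {prec p : ι → ℕ} {kexp nexp : ℕ} {Sp Sm : ι → IntervalD} {bD : ι → Dyad} {Eb Et c₀ : ℚ} {Mq : ℤ → ℚ}
    {rec : ι → ℕ → VRec} {j₁ j₂ : ι → ℕ} {sr : ι → ℕ → SecRec} {qz : ι → Array ℤ} {lev : ι → ℚ}
    {i₀ : Fin m} {σ ρ Zx : ℚ} {θn θd : ℕ} {Cs : ι → ℕ → ℚ} {ell cen chw : ι → ℕ → Array Dyad}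
    (hg : ∀ b, checkGlobalG m Kb Ka (prec b) shifts (cB b) q (Sp b) (Sm b) (bD b) = true)
    (hj : ∀ b, j₁ b ≤ j₂ b)
    (hs : ∀ b j, j < j₂ b + 1 → checkStepG m Kb Ka (prec b) (p b) kexp nexp shifts (cB b) αq (ωq b) (Sp b) (Sm b) (bD b) Eb Et (rec b) j = true)
    (hsec : ∀ b j, j₁ b ≤ j → j ≤ j₂ b →
      checkSection m Kb Ka (prec b) shifts (cB b) (qz b) (rec b j).lo (rec b j).hi (rec b j).δ (sr b j) = true)
    (hread : ∀ b j, j₁ b ≤ j → j ≤ j₂ b →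
      checkReadoutL m Kb Ka (ωq b) i₀ q σ ρ r Zx Et θn θd wq (Cs b j) (ell b j) (cen b j) (chw b j)
        (xsArr (m * winLen Kb Ka) (qz b) (sr b j) (rec b j).x (lev b)) (csArr (m * winLen Kb Ka) (qz b) (sr b j) (rec b j).C) (rec b j).r
        (esArr (m * winLen Kb Ka) (qz b) (sr b j) (rec b j).E (rec b j).h) = true)
    (hcoreL : ∀ b j, j₁ b ≤ j → j ≤ j₂ b → ∀ z : Fin m → ℤ → ℝ, InCoreBox Kb Ka (Cs b j) (cen b j) (chw b j) z → Core z)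
    (hbefore : ∀ b, checkSecBelow (m * winLen Kb Ka) (qz b) (rec b (j₁ b)) (lev b) = true)
    (hafter : ∀ b, checkSecAbove (m * winLen Kb Ka) (qz b) (rec b (j₂ b + 1)) (lev b) = true)
    (hpos : ∀ b, 0 < sumHV (rec b) (j₁ b)) (hc₀ : ∀ b, sumHV (rec b) (j₂ b + 1) ≤ c₀)
    (hid : ∀ b, checkIdFrame (m * winLen Kb Ka) (rec b 0).C = true) (hE : ∀ b, checkNonneg (m * winLen Kb Ka) (rec b 0).E = true)
    (hcover : ∀ (z S₀ : Fin m → ℤ → ℝ), Core z → (∀ i k, -Kb ≤ k → k ≤ Ka → (wq k : ℝ) * |S₀ i k - z i k| ≤ (r : ℝ)) →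
      ∃ b, ∀ d, |pxcoord Kb Ka (fun i k => (ωq b i k : ℝ)) S₀ d - dvec (n := m * winLen Kb Ka) (rec b 0).x d| ≤
        dvec (n := m * winLen Kb Ka) (rec b 0).r d) :
    ∀ (z : Fin m → ℤ → ℝ) (S : Fin m → ℤ → ℝ → ℝ), Core z →
      (∀ i k, -Kb ≤ k → k ≤ Ka → (wq k : ℝ) * |S i k 0 - z i k| ≤ (r : ℝ)) →
      (∀ i k, -Kb ≤ k → k ≤ Ka → ∀ u ∈ Icc 0 (c₀ : ℝ),
        HasDerivWithinAt (S i k) (quadTermOn shifts.toFinset (q : ℝ) (fun i₁ i₂ i μ => (αq i₁ i₂ i μ : ℝ)) S i k u) (Icc 0 (c₀ : ℝ)) u) →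
      (∀ i, ContinuousOn (S i (-Kb - 1)) (Icc 0 (c₀ : ℝ))) → (∀ i, ContinuousOn (S i (Ka + 1)) (Icc 0 (c₀ : ℝ))) →
      (∀ i, ∀ u ∈ Icc 0 (c₀ : ℝ), |S i (-Kb - 1) u| ≤ (Eb : ℝ)) →
      (∀ i, ∀ u ∈ Icc 0 (c₀ : ℝ), |S i (Ka + 1) u| ≤ (Et : ℝ)) →
      (∀ i k, -Kb ≤ k → k ≤ Ka → ∀ u ∈ Icc 0 (c₀ : ℝ), |S i k u| ≤ (Mq k : ℝ)) →
        ∃ (τ₁ a' : ℝ) (z' : Fin m → ℤ → ℝ), 0 < τ₁ ∧ τ₁ ≤ (c₀ : ℝ) ∧ 0 < a' ∧ (1 + (q : ℝ)) ^ (-((θn : ℝ) / (θd : ℝ))) ≤ a' ∧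
          (1 + (σ : ℝ)) * a' ≤ |S i₀ 1 τ₁| ∧ Core z' ∧
          (∀ i k, -Kb ≤ k → k + 1 ≤ Ka → (wq k : ℝ) * |S i (1 + k) τ₁ / a' - z' i k| ≤ (ρ : ℝ) * (r : ℝ)) ∧
          (∀ (i : Fin m) (v : ℝ), |v| ≤ (Et : ℝ) → (wq Ka : ℝ) * |v / a' - z' i Ka| ≤ (ρ : ℝ) * (r : ℝ)) ∧
          (∀ i, |S i (-Kb) τ₁| ≤ a' * (Zx : ℝ)) := by
  have hstep : ∀ b j, j < j₂ b + 1 → StepCert shifts.toFinset (q : ℝ) (fun i₁ i₂ i μ => (αq i₁ i₂ i μ : ℝ)) Kb Ka (Eb : ℝ) (Et : ℝ)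
      (fun k => (Mq k : ℝ)) (tOfV (rec b)) (nodeOfV Kb Ka (ωq b) (rec b)) (hullOfG Kb Ka shifts (cB b) (ωq b) (rec b)) j :=
    fun b j hjb => stepCert_of_checkStepG hKb hKa hnd h𝕊 (hω b) (hcoef b) (hg b) (hs b j hjb)
  have hmono : ∀ b j, j < j₂ b + 1 → tOfV (rec b) j < tOfV (rec b) (j + 1) := by
    intro b j hjb
    have h := hs b j hjb
    simp only [checkStepG, Bool.and_eq_true, decide_eq_true_eq] at h
    exact tOfV_lt_succ h.1.1.1.1.1.1.1.1.1.1.1.2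
  have hpos' : ∀ b, 0 < tOfV (rec b) (j₁ b) := fun b => by
    have : ((0 : ℚ) : ℝ) < ((sumHV (rec b) (j₁ b) : ℚ) : ℝ) := by exact_mod_cast hpos b
    have e : tOfV (rec b) (j₁ b) = ((sumHV (rec b) (j₁ b) : ℚ) : ℝ) := by simp [tOfV, sumHV]
    rw [e]; simpa using this
  have hc₀' : ∀ b, tOfV (rec b) (j₂ b + 1) ≤ (c₀ : ℝ) := fun b => by
    have e : tOfV (rec b) (j₂ b + 1) = ((sumHV (rec b) (j₂ b + 1) : ℚ) : ℝ) := by simp [tOfV, sumHV]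
    rw [e]; exact_mod_cast hc₀ b
  have hread' : ∀ b j, j₁ b ≤ j → j ≤ j₂ b → StepRead shifts.toFinset (q : ℝ) (fun i₁ i₂ i μ => (αq i₁ i₂ i μ : ℝ)) Kb Ka (Eb : ℝ) (Et : ℝ)
      (fun k => (Mq k : ℝ)) (tOfV (rec b)) (nodeOfV Kb Ka (ωq b) (rec b))
      (fun y => secQ (qvec (n := m * winLen Kb Ka) (qz b)) (pxcoord Kb Ka (fun i k => (ωq b i k : ℝ)) y) = (lev b : ℝ) →
        ∃ (a' : ℝ) (z' : Fin m → ℤ → ℝ), 0 < a' ∧ (1 + (q : ℝ)) ^ (-((θn : ℝ) / (θd : ℝ))) ≤ a' ∧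
          (1 + (σ : ℝ)) * a' ≤ |y i₀ 1| ∧ Core z' ∧
          (∀ i k, -Kb ≤ k → k + 1 ≤ Ka → (wq k : ℝ) * |y i (1 + k) / a' - z' i k| ≤ (ρ : ℝ) * (r : ℝ)) ∧
          (∀ (i : Fin m) (v : ℝ), |v| ≤ (Et : ℝ) → (wq Ka : ℝ) * |v / a' - z' i Ka| ≤ (ρ : ℝ) * (r : ℝ)) ∧
          (∀ i, |y i (-Kb)| ≤ a' * (Zx : ℝ))) j :=
    fun b j hj1 hj2 => stepRead_readoutL_of_checksG hKb hKa hnd h𝕊 hq (hω b) (hcoef b) (hg b) (hs b j (by omega)) (hsec b j hj1 hj2)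
      (hread b j hj1 hj2) (hcoreL b j hj1 hj2)
  have key := hland_of_pbranchMeshes' (𝕊 := shifts.toFinset) (ε₀ := (q : ℝ)) (α := fun i₁ i₂ i μ => (αq i₁ i₂ i μ : ℝ)) (Kb := Kb) (Ka := Ka)
    (Eb := (Eb : ℝ)) (Et := (Et : ℝ)) (M := fun k => (Mq k : ℝ)) (Core := Core) (w := fun k => (wq k : ℝ)) (r := (r : ℝ))
    (Box := fun b S₀ => ∀ d, |pxcoord Kb Ka (fun i k => (ωq b i k : ℝ)) S₀ d - dvec (n := m * winLen Kb Ka) (rec b 0).x d| ≤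
      dvec (n := m * winLen Kb Ka) (rec b 0).r d)
    (t := fun b => tOfV (rec b)) (Node := fun b => nodeOfV Kb Ka (ωq b) (rec b))
    (Hull := fun b => hullOfG Kb Ka shifts (cB b) (ωq b) (rec b)) (ρ := (ρ : ℝ)) (θ₀ := (θn : ℝ) / (θd : ℝ)) (σ := (σ : ℝ))
    (c₀ := (c₀ : ℝ)) (Zx := (Zx : ℝ)) (i₀ := i₀)
    (sec := fun b y => secQ (qvec (n := m * winLen Kb Ka) (qz b)) (pxcoord Kb Ka (fun i k => (ωq b i k : ℝ)) y)) (lev := fun b => (lev b : ℝ))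
    (j₁ := j₁) (j₂ := j₂) hcover hj (fun b => tOfV_zero (rec b)) hmono hpos' hc₀'
    (fun b y hy => node0_of_boxV (hid b) (hE b) hy) hstep
    (fun b s S hrun => continuousOn_secQ_of_windowRun hKb hKa _ _ hrun)
    (fun b y hy => sec_lt_of_checkSecBelow (hbefore b) hy) (fun b y hy => le_sec_of_checkSecAbove (hafter b) hy) hread'
  exact key

end CertificateGlueOn

end Summit.NavierStokesRegularity.NavierStokesRegularity.Theorems
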